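import Summits.QuantumAdvantage.AdviceFreeQNC0.FibreDecimation37Twist
import HarnessLib

/-!
# Cell qa-qnc0, `p = 3` — ROUND-37P2 File B, STEP 3′ (part 2): the parity of a family of MOD-3 tests on a PARITY CLASS of
# the cube under the "heavy-code" hypothesis (NH) — Parseval / Cauchy–Schwarz, no general position

Planner qa-qnc0-p2 g37, ROUND-37P2 §2, STEP 3′ of Theorem 37.F′, as a self-contained character-sum theorem.  Tests
`[ℓ_k(u) ∈ A_k]` (`A_k ⊆ ℤ/3`, `ℓ_k(u) = Σ_{i : u_i} δ_{k,i}`) on `u ∈ {0,1}^ι`; the tests outside a set `J` are trivial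
(`A_k = ∅`), one test `k₀` is genuine (`∅ ≠ A_{k₀} ≠ ℤ/3`).  If the combined forms of the non-zero coefficient patterns
supported on `J` satisfy `Σ_s (3/4)^{wt(Σ_k s_k δ_k)} ≤ 1/50`, then on either parity class `E_p = {u : |u| ≡ p}` (`ι ≠ ∅`)
the number of firing tests has a prescribed parity for at most `(7/8)·2^{|ι|−1}` points (**`card_parityClass_filter_le`**).

Route: `card_parityClass` (`|E_p| = 2^{|ι|−1}` via `Σ_u (−1)^{|u|} = 0`); `norm_twisted_sum_le`: expand (part 1), kill the
patterns touching a trivial test, bound the zero pattern by `1/3` (untwisted; `‖a_{k₀,0}‖ = 1/3`) resp. `0` (twisted), and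
Cauchy–Schwarz over the remaining patterns: `Σ|ĉ_s|(√3/2)^{wt} ≤ (Σ|ĉ_s|²)^{1/2}(Σ(3/4)^{wt})^{1/2} ≤ √(1/50) < 5/24` with
`Σ_s|ĉ_s|² = ∏_k Σ_t‖a_{k,t}‖² = 1`; finally `2·Σ_{E_p}(−1)^{#fire} = T₀ ± T₁` gives `|Σ_{E_p}(−1)^{#fire}| ≤ (3/4)·2^{|ι|−1}`.

The cell's statement (planner p2 g37), not in print in this form.  WHAT THIS IS NOT: nothing about the game; the decimation
step is `FibreDecimation37Identity.lean`, the assembly of Theorem 37.F′ is the sequel.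
-/

noncomputable section

namespace Summit.QuantumAdvantage.AdviceFreeQNC0.Exp37

open Finset ZMod
open Literature.Computability.MetaComplexity Literature.Computability.MetaComplexity.ModTestProduct
open Literature.Computability.MetaComplexity.TwoModuli

/-! ### The parity-class count -/

section Count

variable {ι : Type*} [Fintype ι] [DecidableEq ι] {κ : Type*} [Fintype κ] [DecidableEq κ]

omit [DecidableEq ι] [Fintype κ] [DecidableEq κ] in
/-- `(−1)^{|u|} = ∏_i (u_i ? −1 : 1)` in any commutative ring. -/
theorem neg_one_pow_card_eq_prod {R : Type*} [CommRing R] (u : ι → Bool) :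
    (-1 : R) ^ (univ.filter fun i => u i = true).card = ∏ i, (if u i then (-1 : R) else 1) := by
  rw [prod_ite, prod_const_one, mul_one, prod_const]

omit [Fintype κ] [DecidableEq κ] in
/-- On a non-empty cube `Σ_u (−1)^{|u|} = 0`. -/
theorem sum_neg_one_pow_card (hι : 0 < Fintype.card ι) :
    ∑ u : ι → Bool, (-1 : ℝ) ^ (univ.filter fun i => u i = true).card = 0 := by
  simp_rw [neg_one_pow_card_eq_prod]
  rw [sum_bool_fun_prod (fun (_ : ι) (b : Bool) => if b then (-1 : ℝ) else 1)]
  obtain ⟨i⟩ := Fintype.card_pos_iff.1 hι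
  exact prod_eq_zero (mem_univ i) (by norm_num)

omit [Fintype κ] [DecidableEq κ] in
/-- **Each parity class is half the cube**: `#{u : |u| ≡ p} = 2^{|ι|−1}` (`ι ≠ ∅`). -/
theorem card_parityClass (hι : 0 < Fintype.card ι) (p : ℕ) :
    ((univ.filter fun u : ι → Bool => (univ.filter fun i => u i = true).card % 2 = p % 2).card : ℝ) =
      (2 : ℝ) ^ (Fintype.card ι - 1) := by
  have hsum := card_filter_add_card_filter_not (s := (univ : Finset (ι → Bool)))
    (fun u : ι → Bool => (univ.filter fun i => u i = true).card % 2 = 0)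
  rw [card_univ, Fintype.card_fun, Fintype.card_bool] at hsum
  -- the signed count vanishes
  have hpos : ∀ u ∈ univ.filter (fun u : ι → Bool => (univ.filter fun i => u i = true).card % 2 = 0),
      (-1 : ℝ) ^ (univ.filter fun i => u i = true).card = 1 :=
    fun u hu => (Nat.even_iff.2 (mem_filter.1 hu).2).neg_one_pow
  have hneg : ∀ u ∈ univ.filter (fun u : ι → Bool => ¬ (univ.filter fun i => u i = true).card % 2 = 0),
      (-1 : ℝ) ^ (univ.filter fun i => u i = true).card = -1 :=
    fun u hu => (Nat.odd_iff.2 (by have := (mem_filter.1 hu).2; omega)).neg_one_pow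
  have hdiff : ((univ.filter fun u : ι → Bool => (univ.filter fun i => u i = true).card % 2 = 0).card : ℝ) -
      ((univ.filter fun u : ι → Bool => ¬ (univ.filter fun i => u i = true).card % 2 = 0).card : ℝ) = 0 := by
    rw [← sum_neg_one_pow_card hι, ← sum_filter_add_sum_filter_not univ
      (fun u : ι → Bool => (univ.filter fun i => u i = true).card % 2 = 0), sum_congr rfl hpos, sum_congr rfl hneg]
    simp [sub_eq_add_neg]
  have hpow : ((2 : ℝ) ^ Fintype.card ι) = 2 * (2 : ℝ) ^ (Fintype.card ι - 1) := by
    rw [← pow_succ']; congr 1; omega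
  have hsumR : ((univ.filter fun u : ι → Bool => (univ.filter fun i => u i = true).card % 2 = 0).card : ℝ) +
      ((univ.filter fun u : ι → Bool => ¬ (univ.filter fun i => u i = true).card % 2 = 0).card : ℝ) =
      (2 : ℝ) ^ Fintype.card ι := by
    exact_mod_cast hsum
  rcases Nat.mod_two_eq_zero_or_one p with hp | hp
  · rw [hp]; linarith
  · rw [hp]
    have e : (univ.filter fun u : ι → Bool => (univ.filter fun i => u i = true).card % 2 = 1) =
        univ.filter fun u : ι → Bool => ¬ (univ.filter fun i => u i = true).card % 2 = 0 :=
      filter_congr fun u _ => by omega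
    rw [e]; linarith

omit [DecidableEq ι] [DecidableEq κ] in
/-- The product of the sign tests is `(−1)^{#{tests that fire}}`. -/
theorem prod_signTest_eq (δ : κ → ι → ZMod 3) (A : κ → Finset (ZMod 3)) (u : ι → Bool) :
    ∏ k, signTest (A k) (subsetSum (δ k) u) = (-1 : ℂ) ^ (univ.filter fun k => subsetSum (δ k) u ∈ A k).card := by
  unfold signTest
  rw [prod_ite, prod_const_one, mul_one, prod_const]

/-- `(−1)^a (−1)^b = ±1` according to the parities. -/
theorem neg_one_pow_mul_neg_one_pow (a b : ℕ) :
    (-1 : ℝ) ^ a * (-1) ^ b = if a % 2 = b % 2 then 1 else -1 := by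
  rw [← pow_add]
  split_ifs with h
  · exact (Nat.even_iff.2 (by omega)).neg_one_pow
  · exact (Nat.odd_iff.2 (by omega)).neg_one_pow

/-- **The bound on the twisted sums.**  With trivial tests off `J`, a genuine test `k₀`, and the (NH) sum `≤ 1/50`:
`‖Σ_u (−1)^{#fire(u)} χ₂(t)^{|u|}‖ ≤ 2^{|ι|}·([t = 0]/3 + 5/24)`. -/
theorem norm_twisted_sum_le (δ : κ → ι → ZMod 3) (A : κ → Finset (ZMod 3)) (J : Finset κ)
    (hJ : ∀ k, k ∉ J → A k = ∅) (k₀ : κ) (hk₀ : (A k₀).Nonempty) (hk₀' : A k₀ ≠ univ)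
    (hι : 0 < Fintype.card ι)
    (hW : ∑ s ∈ univ.filter (fun s : κ → ZMod 3 => s ≠ 0 ∧ ∀ k, k ∉ J → s k = 0),
      ((3 : ℝ) / 4) ^ wt (combo δ s) ≤ 1 / 50)
    (t : ZMod 2) :
    ‖∑ u : ι → Bool, (-1 : ℂ) ^ (univ.filter fun k => subsetSum (δ k) u ∈ A k).card *
        (stdAddChar t : ℂ) ^ (univ.filter fun i => u i = true).card‖
      ≤ (2 : ℝ) ^ Fintype.card ι * ((if t = 0 then (1 : ℝ) / 3 else 0) + 5 / 24) := by
  classical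
  set a : κ → ZMod 3 → ℂ := fun k => fcoef (signTest (A k)) with ha
  have hmain := norm_sum_prod_twist_le δ a (fun k => signTest (A k)) (fun k v => fourier_inversion _ v) t
  simp_rw [prod_signTest_eq] at hmain
  refine hmain.trans ?_
  -- abbreviations
  set c : (κ → ZMod 3) → ℝ := fun s => ∏ k, ‖a k (s k)‖ with hc
  set S' : Finset (κ → ZMod 3) := univ.filter (fun s : κ → ZMod 3 => s ≠ 0 ∧ ∀ k, k ∉ J → s k = 0) with hS'
  have hc_nonneg : ∀ s, 0 ≤ c s := fun s => prod_nonneg fun k _ => norm_nonneg _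
  -- patterns touching a trivial test contribute nothing
  have hc_zero : ∀ s : κ → ZMod 3, s ≠ 0 → s ∉ S' → c s = 0 := by
    intro s hs0 hs
    have : ¬ ∀ k, k ∉ J → s k = 0 := fun h => hs (mem_filter.2 ⟨mem_univ _, hs0, h⟩)
    push Not at this
    obtain ⟨k, hkJ, hsk⟩ := this
    refine prod_eq_zero (mem_univ k) ?_
    rw [ha]; dsimp only
    rw [hJ k hkJ, fcoef_signTest_empty hsk, norm_zero]
  -- the zero pattern: `c 0 ≤ 1/3`
  have hc0 : c 0 ≤ 1 / 3 := by
    rw [hc]; dsimp only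
    rw [← mul_prod_erase univ _ (mem_univ k₀)]
    have h1 : ‖a k₀ ((0 : κ → ZMod 3) k₀)‖ = 1 / 3 := by
      rw [ha]; exact fcoef_sign_norm_zero _ (signTest_sign' _) (signTest_nonconst' hk₀ hk₀')
    rw [h1]
    have h2 : ∏ k ∈ univ.erase k₀, ‖a k ((0 : κ → ZMod 3) k)‖ ≤ 1 := by
      calc ∏ k ∈ univ.erase k₀, ‖a k ((0 : κ → ZMod 3) k)‖ ≤ ∏ k ∈ univ.erase k₀, (1 : ℝ) :=
            prod_le_prod (fun k _ => norm_nonneg _) fun k _ => norm_fcoef_signTest_le_one _ _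
        _ = 1 := prod_const_one
    linarith [mul_le_mul_of_nonneg_left h2 (by norm_num : (0 : ℝ) ≤ 1 / 3)]
  -- Parseval over all patterns: `Σ_s c_s² = 1`
  have hpars : ∑ s : κ → ZMod 3, c s ^ 2 = 1 := by
    have e : ∀ s : κ → ZMod 3, c s ^ 2 = ∏ k, ‖a k (s k)‖ ^ 2 := fun s => by rw [hc]; dsimp only; rw [prod_pow]
    simp_rw [e]
    rw [← Fintype.prod_sum (fun k tk => ‖a k tk‖ ^ 2)]
    exact prod_eq_one fun k _ => sum_norm_sq_fcoef_signTest (A k)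
  -- Cauchy–Schwarz on the non-zero patterns supported on `J`
  set X : ℝ := ∑ s ∈ S', c s * (Real.sqrt 3 / 2) ^ wt (combo δ s) with hX
  have hX_nonneg : 0 ≤ X := sum_nonneg fun s _ => mul_nonneg (hc_nonneg s) (by positivity)
  have hXle : X ≤ 5 / 24 := by
    have hcs := sum_mul_sq_le_sq_mul_sq S' c (fun s => (Real.sqrt 3 / 2) ^ wt (combo δ s))
    have h1 : ∑ s ∈ S', c s ^ 2 ≤ 1 := by
      rw [← hpars]
      exact sum_le_sum_of_subset_of_nonneg (filter_subset _ _) fun s _ _ => sq_nonneg _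
    have h2 : ∑ s ∈ S', ((Real.sqrt 3 / 2) ^ wt (combo δ s)) ^ 2 ≤ 1 / 50 := by
      refine le_trans (le_of_eq (sum_congr rfl fun s _ => ?_)) hW
      rw [← pow_mul, mul_comm, pow_mul, div_pow, Real.sq_sqrt (by norm_num : (0 : ℝ) ≤ 3)]
      norm_num
    have hsq : X ^ 2 ≤ 1 * (1 / 50) :=
      hcs.trans (mul_le_mul h1 h2 (sum_nonneg fun s _ => sq_nonneg _) (by norm_num))
    nlinarith [hX_nonneg, hsq]
  -- assemble: split the sum over patterns into `0`, `S'`, and the rest (which vanishes)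
  have hsplit : ∑ s : κ → ZMod 3, c s * ∏ i, ‖(1 : ℂ) + stdAddChar (combo δ s i) * stdAddChar t‖
      = c 0 * ∏ i, ‖(1 : ℂ) + stdAddChar (combo δ 0 i) * stdAddChar t‖ +
        ∑ s ∈ S', c s * ∏ i, ‖(1 : ℂ) + stdAddChar (combo δ s i) * stdAddChar t‖ := by
    rw [← sum_erase_add _ _ (mem_univ (0 : κ → ZMod 3)), add_comm]
    congr 1
    symm
    refine sum_subset (fun s hs => mem_erase.2 ⟨(mem_filter.1 hs).2.1, mem_univ _⟩) fun s hs hs' => ?_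
    rw [hc_zero s (ne_of_mem_erase hs) hs', zero_mul]
  have hcombo0 : combo δ (0 : κ → ZMod 3) = 0 := by
    funext i; unfold combo; simp
  rw [show (∑ s : κ → ZMod 3, (∏ k, ‖a k (s k)‖) * ∏ i, ‖(1 : ℂ) + stdAddChar (combo δ s i) * stdAddChar t‖)
      = ∑ s : κ → ZMod 3, c s * ∏ i, ‖(1 : ℂ) + stdAddChar (combo δ s i) * stdAddChar t‖ from rfl, hsplit, hcombo0]
  -- the `S'` part
  have hS'le : ∑ s ∈ S', c s * ∏ i, ‖(1 : ℂ) + stdAddChar (combo δ s i) * stdAddChar t‖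
      ≤ (2 : ℝ) ^ Fintype.card ι * X := by
    rw [hX, mul_sum]
    refine sum_le_sum fun s _ => ?_
    calc c s * ∏ i, ‖(1 : ℂ) + stdAddChar (combo δ s i) * stdAddChar t‖
        ≤ c s * ((2 : ℝ) ^ Fintype.card ι * (Real.sqrt 3 / 2) ^ wt (combo δ s)) :=
          mul_le_mul_of_nonneg_left (prod_norm_twist_le _ t) (hc_nonneg s)
      _ = _ := by ring
  -- the zero pattern
  have h0le : c 0 * ∏ i : ι, ‖(1 : ℂ) + stdAddChar ((0 : ι → ZMod 3) i) * stdAddChar t‖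
      ≤ (2 : ℝ) ^ Fintype.card ι * (if t = 0 then (1 : ℝ) / 3 else 0) := by
    by_cases ht : t = 0
    · rw [if_pos ht, ht]
      have hprod : ∏ i : ι, ‖(1 : ℂ) + stdAddChar ((0 : ι → ZMod 3) i) * stdAddChar (0 : ZMod 2)‖
          = (2 : ℝ) ^ Fintype.card ι := by
        simp only [Pi.zero_apply, AddChar.map_zero_eq_one, mul_one]
        rw [prod_const, card_univ]; norm_num
      rw [hprod, mul_comm]
      exact mul_le_mul_of_nonneg_left hc0 (by positivity)
    · rw [if_neg ht]
      have ht01 : ∀ t' : ZMod 2, t' = 0 ∨ t' = 1 := by decide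
      have ht1 : t = 1 := by
        rcases ht01 t with h | h
        · exact absurd h ht
        · exact h
      rw [ht1]
      simp only [Pi.zero_apply]
      rw [prod_norm_twist_zero hι]; simp
  calc c 0 * ∏ i : ι, ‖(1 : ℂ) + stdAddChar ((0 : ι → ZMod 3) i) * stdAddChar t‖ +
        ∑ s ∈ S', c s * ∏ i, ‖(1 : ℂ) + stdAddChar (combo δ s i) * stdAddChar t‖
      ≤ (2 : ℝ) ^ Fintype.card ι * (if t = 0 then (1 : ℝ) / 3 else 0) + (2 : ℝ) ^ Fintype.card ι * X :=
        add_le_add h0le hS'le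
    _ ≤ (2 : ℝ) ^ Fintype.card ι * ((if t = 0 then (1 : ℝ) / 3 else 0) + 5 / 24) := by
        rw [mul_add]
        exact add_le_add le_rfl (mul_le_mul_of_nonneg_left hXle (by positivity))

/-- **STEP 3′ (the parity-class count).**  Tests `[ℓ_k(u) ∈ A_k]` on the cube `{0,1}^ι` (`ι ≠ ∅`), trivial off `J`
(`A_k = ∅`), genuine at `k₀`; if the non-zero patterns supported on `J` satisfy `Σ_s (3/4)^{wt(Σ_k s_kδ_k)} ≤ 1/50`, then on the
parity class `{u : |u| ≡ p}` the number of firing tests has parity `c` for at most `(7/8)·2^{|ι|−1}` points. -/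
theorem card_parityClass_filter_le (δ : κ → ι → ZMod 3) (A : κ → Finset (ZMod 3)) (J : Finset κ)
    (hJ : ∀ k, k ∉ J → A k = ∅) (k₀ : κ) (hk₀ : (A k₀).Nonempty) (hk₀' : A k₀ ≠ univ)
    (hι : 0 < Fintype.card ι)
    (hW : ∑ s ∈ univ.filter (fun s : κ → ZMod 3 => s ≠ 0 ∧ ∀ k, k ∉ J → s k = 0),
      ((3 : ℝ) / 4) ^ wt (combo δ s) ≤ 1 / 50)
    (p c : ℕ) :
    ((univ.filter fun u : ι → Bool =>
        (univ.filter fun i => u i = true).card % 2 = p % 2 ∧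
        (univ.filter fun k => subsetSum (δ k) u ∈ A k).card % 2 = c % 2).card : ℝ)
      ≤ 7 / 8 * (2 : ℝ) ^ (Fintype.card ι - 1) := by
  classical
  -- notation
  set wtu : (ι → Bool) → ℕ := fun u => (univ.filter fun i => u i = true).card with hwtu
  set N : (ι → Bool) → ℕ := fun u => (univ.filter fun k => subsetSum (δ k) u ∈ A k).card with hN
  set E : Finset (ι → Bool) := univ.filter fun u => wtu u % 2 = p % 2 with hE
  -- the signed count on the class
  set R : ℝ := ∑ u ∈ E, (-1 : ℝ) ^ N u with hR
  -- (1) `2R = T₀ + (−1)^p T₁` and the norm bounds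
  have hT : ∀ t : ZMod 2, ‖∑ u : ι → Bool, (-1 : ℂ) ^ N u * (stdAddChar t : ℂ) ^ wtu u‖
      ≤ (2 : ℝ) ^ Fintype.card ι * ((if t = 0 then (1 : ℝ) / 3 else 0) + 5 / 24) :=
    fun t => norm_twisted_sum_le δ A J hJ k₀ hk₀ hk₀' hι hW t
  have hRC : ((R : ℝ) : ℂ) = ∑ u ∈ E, (-1 : ℂ) ^ N u := by
    rw [hR]; push_cast; rfl
  have hRid : (∑ u : ι → Bool, (-1 : ℂ) ^ N u * (stdAddChar (0 : ZMod 2) : ℂ) ^ wtu u) +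
      (-1 : ℂ) ^ p * (∑ u : ι → Bool, (-1 : ℂ) ^ N u * (stdAddChar (1 : ZMod 2) : ℂ) ^ wtu u) =
      2 * ∑ u ∈ E, (-1 : ℂ) ^ N u := by
    rw [AddChar.map_zero_eq_one, stdAddChar_two_one, mul_sum, ← sum_add_distrib,
      ← sum_filter_add_sum_filter_not univ (fun u : ι → Bool => wtu u % 2 = p % 2)]
    have hon : ∀ u ∈ univ.filter (fun u : ι → Bool => wtu u % 2 = p % 2),
        (-1 : ℂ) ^ N u * (1 : ℂ) ^ wtu u + (-1 : ℂ) ^ p * ((-1 : ℂ) ^ N u * (-1 : ℂ) ^ wtu u) =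
          2 * (-1 : ℂ) ^ N u := by
      intro u hu
      have h := (mem_filter.1 hu).2
      have hsgn := neg_one_pow_mul_neg_one_pow p (wtu u)
      rw [if_pos (by omega)] at hsgn
      have hsgnC : ((-1 : ℂ) ^ p) * (-1) ^ wtu u = 1 := by exact_mod_cast hsgn
      rw [one_pow]
      linear_combination ((-1 : ℂ) ^ N u) * hsgnC
    have hoff : ∀ u ∈ univ.filter (fun u : ι → Bool => ¬ wtu u % 2 = p % 2),
        (-1 : ℂ) ^ N u * (1 : ℂ) ^ wtu u + (-1 : ℂ) ^ p * ((-1 : ℂ) ^ N u * (-1 : ℂ) ^ wtu u) = 0 := by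
      intro u hu
      have h := (mem_filter.1 hu).2
      have hsgn := neg_one_pow_mul_neg_one_pow p (wtu u)
      rw [if_neg (by omega)] at hsgn
      have hsgnC : ((-1 : ℂ) ^ p) * (-1) ^ wtu u = -1 := by exact_mod_cast hsgn
      rw [one_pow]
      linear_combination ((-1 : ℂ) ^ N u) * hsgnC
    rw [sum_congr rfl hon, sum_congr rfl hoff, sum_const_zero, add_zero, ← mul_sum]
  have hRabs : 2 * |R| ≤ (2 : ℝ) ^ Fintype.card ι * (3 / 4) := by
    have h : ‖(2 : ℂ) * ((R : ℝ) : ℂ)‖ = ‖(∑ u : ι → Bool, (-1 : ℂ) ^ N u * (stdAddChar (0 : ZMod 2) : ℂ) ^ wtu u) +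
        (-1 : ℂ) ^ p * (∑ u : ι → Bool, (-1 : ℂ) ^ N u * (stdAddChar (1 : ZMod 2) : ℂ) ^ wtu u)‖ := by
      rw [hRid, hRC]
    rw [norm_mul, Complex.norm_real, Real.norm_eq_abs] at h
    have h2 : ‖(2 : ℂ)‖ = 2 := by simp
    rw [h2] at h
    rw [h]
    refine (norm_add_le _ _).trans ?_
    rw [norm_mul]
    have hp1 : ‖(-1 : ℂ) ^ p‖ = 1 := by simp
    rw [hp1, one_mul]
    have h0 := hT 0
    have h1 := hT 1
    rw [if_pos rfl] at h0
    rw [if_neg (by decide)] at h1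
    linarith
  -- (2) the class has `2^{|ι|−1}` points, split by the parity of `N`
  have hEcard : (E.card : ℝ) = (2 : ℝ) ^ (Fintype.card ι - 1) := card_parityClass hι p
  have hsplit := card_filter_add_card_filter_not (s := E) (fun u => N u % 2 = 0)
  have hpos : ∀ u ∈ E.filter (fun u => N u % 2 = 0), (-1 : ℝ) ^ N u = 1 :=
    fun u hu => (Nat.even_iff.2 (mem_filter.1 hu).2).neg_one_pow
  have hneg : ∀ u ∈ E.filter (fun u => ¬ N u % 2 = 0), (-1 : ℝ) ^ N u = -1 :=
    fun u hu => (Nat.odd_iff.2 (by have := (mem_filter.1 hu).2; omega)).neg_one_pow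
  have hRsplit : R = ((E.filter fun u => N u % 2 = 0).card : ℝ) - ((E.filter fun u => ¬ N u % 2 = 0).card : ℝ) := by
    rw [hR, ← sum_filter_add_sum_filter_not E (fun u => N u % 2 = 0), sum_congr rfl hpos, sum_congr rfl hneg]
    simp [sub_eq_add_neg]
  have hpow : (2 : ℝ) ^ Fintype.card ι = 2 * (2 : ℝ) ^ (Fintype.card ι - 1) := by
    rw [← pow_succ']; congr 1; omega
  -- (3) the target set is one of the two parts
  have htarget : (univ.filter fun u : ι → Bool => wtu u % 2 = p % 2 ∧ N u % 2 = c % 2) =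
      E.filter fun u => N u % 2 = c % 2 := by
    rw [hE, filter_filter]
  rw [htarget]
  have hsplitR : ((E.filter fun u => N u % 2 = 0).card : ℝ) + ((E.filter fun u => ¬ N u % 2 = 0).card : ℝ)
      = E.card := by exact_mod_cast hsplit
  rcases Nat.mod_two_eq_zero_or_one c with hc | hc
  · rw [hc]
    have habs := le_abs_self R
    linarith
  · rw [hc]
    have e : (E.filter fun u => N u % 2 = 1) = E.filter fun u => ¬ N u % 2 = 0 :=
      filter_congr fun u _ => by omega
    rw [e]
    have habs := neg_abs_le R
    linarith

end Count

end Summit.QuantumAdvantage.AdviceFreeQNC0.Exp37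

end
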